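import Summits.BirchSwinnertonDyer.Rank1Residual.Additive.RationalLineOfKernelPolynomial
import Literature.NumberTheory.GaloisRepresentations.GL2F5OrderThree
import HarnessLib

/-!
# X3♯(G-ord, `e = 2`) at `p = 5`: the FIRST KERNEL RECORD of a rational `5`-line from the engines'
# kernel polynomial — prototype row `2475h` (member `2475h2`), via
# `KernelPolyLine.exists_isRationalLine_of_kernelPolyCert` (cell `bsd-addord`, seat `bsd-addord-twist`)

HONEST FRAMING (cell `bsd-addord`, `run/shared/lean/pub/bsd-addord/README.md` §4): the programme's
target of record is the full Birch–Swinnerton-Dyer formula for every `E/ℚ` of analytic rank `≤ 1`.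
DATA-RECORDS module, theorems only (no definition, no named fact, no `sorry`); it BOOKS NOTHING and
moves no mark. It is the PROTOTYPE of the `p ≥ 5` twin of `Additive/X3ThreeLineDatumRecords*.lean`
(the per-pair line datum of the B-X3G booking rows, flag `Φ₀-datum data-level@p`): it shows that the
engines' kernel polynomial `h_W` of `HOME/proof/phi0-p5/MANIFEST.tsv` (column `hW_cremona_e2`) is
turned into the tree's `IsRationalLine W 5 Φ` by THREE polynomial identities checked in the kernel —
(c1) `preΨ'₅ = h·q` (Mathlib's univariate `5`-division polynomial, `preΨ'₅ = preΨ₄·Ψ₂Sq² − Ψ₃³`),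
(c2) the doubling closure `h₀Ψ₂Sq² + h₁Φ₂Ψ₂Sq + h₂Φ₂² = h·q₂`, (c3) `⟨2⟩ = 𝔽₅ˣ` — each by
`Polynomial.funext` + `ring` on the explicit integers. The cofactors `q`, `q₂` were obtained by exact
rational polynomial division (a 40-line script in the seat folder; no CAS); the kernel re-verifies them.

Row: class `2475h`, Case-1 member `2475h2 = [0, 0, 1, −2325, 78156]`, `p = 5`, `h = x² − 25x − 1205`
(MANIFEST: EVEN, `χ_{p*}`-twist RAMIFIED = canonical, engines agree). Parity / twisted ramification of
the certified line are NOT recorded here (Files B/C of the programme, HANDOFF §twist gen 6).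

References: J. H. Silverman, *AEC* 2nd ed., Exercise 3.7 [SilvermanAEC2009]; HOME/proof/phi0-p5/
MANIFEST.tsv (row `r0 2475h@5`); `Additive/RationalLineOfKernelPolynomial.lean`.
-/

set_option autoImplicit false

noncomputable section

open WeierstrassCurve Polynomial Literature.NumberTheory.EllipticCurves
  Literature.NumberTheory.EllipticCurves.Rank1Residual Field
  Summit.BirchSwinnertonDyer.Rank1Residual.Additive.KernelPolyLine

namespace Summit.BirchSwinnertonDyer.Rank1Residual.Additive.KernelPolyLineRecords

/-- (c1) for `2475h2` at `5`: `preΨ'₅ = h · q` with `h = X² − 25X − 1205`. [folklore] -/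
theorem preΨ'_five_2475h2 :
    (⟨0, 0, 1, -2325, 78156⟩ : WeierstrassCurve ℚ).preΨ' 5 = (X ^ 2 - C 25 * X - C 1205) *
      (C 5757168140527343750 - C 519448966357421875 * X + C 19312206152343750 * X ^ 2
        - C 263054507812500 * X ^ 3 + C 1886532421875 * X ^ 4 - C 13418578125 * X ^ 5
        - C 68390625 * X ^ 6 + C 26475000 * X ^ 7 - C 135000 * X ^ 8 + C 125 * X ^ 9 + C 5 * X ^ 10) := by
  rw [show (5 : ℕ) = 2 * (0 + 2) + 1 from rfl, preΨ'_odd]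
  rw [if_pos (by decide : Even (0 : ℕ)), if_pos (by decide : Even (0 : ℕ))]
  simp only [zero_add, preΨ'_four, preΨ'_two, preΨ'_one, preΨ'_three, one_pow, mul_one]
  apply Polynomial.funext
  intro r
  simp only [preΨ₄, Ψ₃, Ψ₂Sq, b₂, b₄, b₆, b₈, eval_add, eval_sub, eval_mul, eval_pow, eval_C,
    eval_X, eval_ofNat, eval_one]
  ring

/-- (c2) for `2475h2` at `5`: the doubling-closure identity `∑_{i ≤ 2} h_i Φ₂^i Ψ₂Sq^{2−i} = h · q₂`.
[folklore] -/
theorem dbl_2475h2 :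
    ∑ i ∈ Finset.range (2 + 1), C ((X ^ 2 - C 25 * X - C 1205 : ℚ[X]).coeff i) *
        (⟨0, 0, 1, -2325, 78156⟩ : WeierstrassCurve ℚ).Φ 2 ^ i *
        (⟨0, 0, 1, -2325, 78156⟩ : WeierstrassCurve ℚ).Ψ₂Sq ^ (2 - i) =
      (X ^ 2 - C 25 * X - C 1205) *
        (C 108545640625 - C 7555434375 * X + C 117971250 * X ^ 2 - C 1839625 * X ^ 3 - C 10650 * X ^ 4
          - C 75 * X ^ 5 + X ^ 6) := by
  have hc0 : (X ^ 2 - C 25 * X - C 1205 : ℚ[X]).coeff 0 = -1205 := by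
    simp [coeff_X_pow, coeff_C]
  have hc1 : (X ^ 2 - C 25 * X - C 1205 : ℚ[X]).coeff 1 = -25 := by
    simp [coeff_X_pow, coeff_C]
  have hc2 : (X ^ 2 - C 25 * X - C 1205 : ℚ[X]).coeff 2 = 1 := by
    simp [coeff_X_pow]
  simp only [Finset.sum_range_succ, Finset.sum_range_zero, zero_add, hc0, hc1, hc2, pow_zero, pow_one,
    Nat.sub_zero, Nat.sub_self, show 2 - 1 = 1 from rfl, mul_one, one_mul, map_one]
  apply Polynomial.funext
  intro r
  simp only [Φ_two, Ψ₂Sq, b₂, b₄, b₆, b₈, eval_add, eval_sub, eval_mul, eval_pow, eval_C, eval_X,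
    map_neg, eval_neg]
  ring

/-- (c3) at `p = 5`: every non-zero residue is a power of `2` (`2` generates `𝔽₅ˣ`). [folklore] -/
theorem gen_five : ∀ k : ZMod 5, k ≠ 0 → ∃ (s : ℤˣ) (j : ℕ), k = ((s : ℤ) * 2 ^ j : ℤ) := by
  intro k hk
  have hv : k.val < 5 := k.val_lt
  have hk' : k = (k.val : ZMod 5) := (ZMod.natCast_zmod_val k).symm
  interval_cases h : k.val
  · exact absurd (by rw [hk']; rfl) hk
  · exact ⟨1, 0, by rw [hk']; rfl⟩
  · exact ⟨1, 1, by rw [hk']; rfl⟩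
  · exact ⟨1, 3, by rw [hk']; rfl⟩
  · exact ⟨1, 2, by rw [hk']; rfl⟩

/-- **RECORD `2475h2` at `p = 5`**: `E[5]` of `[0,0,1,−2325,78156]` contains a RATIONAL `5`-LINE whose
non-zero points are exactly above the roots of the engines' kernel polynomial `h = x² − 25x − 1205`
(class `2475h`, (G-ord, `e = 2`) at `5`; MANIFEST row `r0 2475h@5`). [folklore] -/
theorem exists_isRationalLine_2475h2 :
    ∃ Φ : AddSubgroup (geomTorsion (⟨0, 0, 1, -2325, 78156⟩ : WeierstrassCurve ℚ) ((5 : ℕ) : ℤ)),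
      IsRationalLine ⟨0, 0, 1, -2325, 78156⟩ 5 Φ ∧
      ∀ Q ∈ Φ, Q ≠ 0 → ∃ (x y : AlgebraicClosure ℚ)
        (hxy : ((⟨0, 0, 1, -2325, 78156⟩ : WeierstrassCurve ℚ).baseChange
          (AlgebraicClosure ℚ)).toAffine.Nonsingular x y),
        (Q : (⟨0, 0, 1, -2325, 78156⟩ : WeierstrassCurve ℚ).geomPoints) = Affine.Point.some x y hxy ∧
          ((X ^ 2 - C 25 * X - C 1205 : ℚ[X]).map (algebraMap ℚ (AlgebraicClosure ℚ))).eval x = 0 := by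
  haveI : (⟨0, 0, 1, -2325, 78156⟩ : WeierstrassCurve ℚ).IsElliptic := ⟨by
    rw [isUnit_iff_ne_zero]
    norm_num [WeierstrassCurve.Δ, b₂, b₄, b₆, b₈]⟩
  have e : (X ^ 2 - C 25 * X - C 1205 : ℚ[X]) = C 1 * X ^ 2 + C (-25) * X + C (-1205) := by
    simp only [map_one, one_mul, map_neg]; ring
  have hdeg : (X ^ 2 - C 25 * X - C 1205 : ℚ[X]).natDegree ≤ 2 := by
    rw [e]; exact natDegree_quadratic_le
  have hdeg2 : (X ^ 2 - C 25 * X - C 1205 : ℚ[X]).natDegree = 2 := by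
    rw [e]; exact natDegree_quadratic one_ne_zero
  refine exists_isRationalLine_of_kernelPolyCert (by norm_num) (m := 2) rfl hdeg preΨ'_five_2475h2
    dbl_2475h2 gen_five ?_
  -- a root of `h` in `ℚ̄`
  have hne : (X ^ 2 - C 25 * X - C 1205 : ℚ[X]) ≠ 0 :=
    ne_zero_of_natDegree_gt (n := 1) (by rw [hdeg2]; norm_num)
  have hd : ((X ^ 2 - C 25 * X - C 1205 : ℚ[X]).map (algebraMap ℚ (AlgebraicClosure ℚ))).degree ≠ 0 := by
    rw [degree_map, degree_eq_natDegree hne, hdeg2]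
    norm_num
  obtain ⟨α, hα⟩ := IsAlgClosed.exists_root _ hd
  exact ⟨α, hα⟩

end Summit.BirchSwinnertonDyer.Rank1Residual.Additive.KernelPolyLineRecords

end
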